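import Literature.Analysis.FluidPDE.AxisymBiotSavartSupBound
import Literature.Analysis.FluidPDE.AxisymNoSwirlImpulseConservation
import HarnessLib

/-!
# The all-time speed cap for single-signed, finite-impulse axisymmetric flows without swirl —
# UNCONDITIONAL, with the explicit constant `3` (Gallay–Šverák 2015, assembled)

Analysis/FluidPDE literature file, PROOF-ONLY (no definition, no named fact). The tree's
`speedCap_of_facts (hBS : GallaySverak2015.VelocitySupBound) (hI : GallaySverak2015.ImpulseConservation)`
(`AxisymNoSwirlScaleInvariantBounds`) assembles, from the two NAMED FACTS of

> Th. Gallay, V. Šverák, *Remarks on the Cauchy problem for the axisymmetric Navier–Stokes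
> equations*, Confluentes Math. **7** (2015) 67–92 = arXiv:1510.01036 [GallaySverak2016]

— Prop. 2.6 (2.14) (p. 8) `‖u‖_∞ ≤ C‖rω_θ‖_{L¹(Ω)}^{1/2}‖ω_θ/r‖_∞^{1/2}` and Lemma 6.4 (p. 19)
`∫_Ω r²ω_θ(t) dr dz = ∫_Ω r²ω₀ dr dz` — together with Lemma 5.1 (`∫|η(t)| ≤ ∫|η₀|`, tree theorem
`IsTaoSolutionOn.lintegral_abs_angVortQuot_le_of_datum`) and the maximum principle for
`η = ω_θ/r` (`AxisymNoSwirlQuotMaxPrinciple`), the ALL-TIME SPEED CAP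

  `‖u(t, x)‖ ≤ C · √( √((∫η₀ dx)(∫r²η₀ dx)) · M )`,   `t ∈ [0, T]`, `x ∈ ℝ³`,

for every Tao-class solution (`ν = 1`) from an axisymmetric swirl-free datum `u₀` with
`0 ≤ η₀ = angVortQuot u₀ ≤ M`, `η₀ ∈ L¹(ℝ³)`, `r²η₀ ∈ L¹(ℝ³)`.

Both named facts are now THEOREMS of the tree:
`GallaySverak2015.VelocitySupBound_holds` (`AxisymBiotSavartSupBound`, with `C = 3` through
`norm_biotSavart_le_sqrt_of_norm_le_mul_cylRadius`) and `GallaySverak2015.ImpulseConservation_holds`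
(`AxisymNoSwirlImpulseConservation`). This file records the consequences:

* `GallaySverak2015.speedCap` — the cap in the `∃ C ≥ 0` form of `speedCap_of_facts`, with NO
  hypothesis left (the term `speedCap_of_facts VelocitySupBound_holds ImpulseConservation_holds`);
* `IsTaoSolutionOn.integrable_curl_of_datum` / `….integral_norm_curl_le_sqrt_of_datum` — for such
  solutions `ω(t) = curl u(t) ∈ L¹(ℝ³)` with `∫‖ω(t)‖ dx ≤ √((∫η₀ dx)(∫r²η₀ dx))` on `[0, T]`
  (Cauchy–Schwarz between Lemma 5.1 and Lemma 6.4; the intermediate step of `speedCap_of_facts`,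
  now unconditional and exported);
* `GallaySverak2015.speedCap_three` — **the cap with its number**:
  `‖u(t, x)‖ ≤ 3 · √( √((∫η₀ dx)(∫r²η₀ dx)) · M )`, i.e. `3 (∫η₀)^{1/4}(∫r²η₀)^{1/4}M^{1/2}` in the
  3-D normalisation `dx = r dr dθ dz` of the tree (`∫_{ℝ³}‖ω‖ dx = 2π‖rω_θ‖_{L¹(Ω)}`,
  `∫_{ℝ³} r²η dx = 2π𝓘`). The constant `3` is the one PROVED in the tree for (2.14) in this
  normalisation (the paper's `C` in (2.14) is unspecified); nothing sharper is claimed.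

WHAT THIS IS NOT: not a statement about blow-up or regularity of Navier–Stokes — an a-priori,
uniform-in-time sup bound for smooth finite-energy swirl-free axisymmetric solutions (a class that
is globally regular: `axisymmetric_no_swirl_global_regularity_holds`), used by the cell
`pub/ns-blowup` as the «speed-cap lever» on the negative lane of crux `HeredityAtOne`
(stmt-NavierStokesRegularity-19249) of route `PalasekTowerBreakdown`.

## Mathlib / tree search

`lean search 'speedCap_of_facts|speedCap_holds|ImpulseConservation_holds'` (2026-08-26): the
conditional `speedCap_of_facts` and the two `_holds` theorems exist; no unconditional cap and no
explicit constant before this file. Used from the tree: `speedCap_of_facts`,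
`GallaySverak2015.VelocitySupBound_holds`, `GallaySverak2015.ImpulseConservation_holds`,
`norm_biotSavart_le_sqrt_of_norm_le_mul_cylRadius`, `integral_cylRadius_mul_le_sqrt`,
`norm_curl_eq_cylRadius_mul_abs_angVortQuot`, `IsTaoSolutionOn.isAxisymmetric`, `….hasNoSwirl`,
`….angVortQuot_nonneg_of_datum`, `….norm_curl_le_mul_cylRadius_of_datum`,
`….lintegral_abs_angVortQuot_le_of_datum`, `….biotSavart_curl_eq`, `IsAxisymmetric.curl`,
`norm_rotZ`, `contDiff_angVortQuot`, `continuous_curl`.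

## References

* Th. Gallay, V. Šverák, *Remarks on the Cauchy problem for the axisymmetric Navier–Stokes
  equations*, Confluentes Math. 7 (2015) 67–92 = arXiv:1510.01036: Prop. 2.6 (2.14) (p. 8),
  Lemma 5.1 (p. 16), Lemma 6.4 (p. 19). [GallaySverak2016]
* H. Feng, V. Šverák, *On the Cauchy problem for axi-symmetric vortex rings*, Arch. Ration.
  Mech. Anal. 215 (2015) 89–123 (the original form of (2.14)).
-/

noncomputable section

open MeasureTheory Set Function Filter Topology
open scoped RealInnerProductSpace ENNReal NNReal ContDiff

namespace Literature.Analysis.FluidPDE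

/-! ### The cap in `∃ C` form, hypothesis-free -/

/-- **All-time speed cap, unconditional** (Gallay–Šverák 2015, Prop. 2.6 (2.14) + Lemma 5.1 +
Lemma 6.4 + maximum principle, assembled by the tree's `speedCap_of_facts`, both of whose named-fact
hypotheses are now theorems): there is an absolute constant `C ≥ 0` such that for every Tao-class
solution `(u, p)` on `[0, T]` (`0 < T`, `ν = 1`) from an axisymmetric swirl-free datum `u₀` with
`0 ≤ η₀ = angVortQuot u₀ ≤ M`, `η₀ ∈ L¹(ℝ³)`, `r²η₀ ∈ L¹(ℝ³)`, every `t ∈ [0, T]` and `x ∈ ℝ³`,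
`‖u(t, x)‖ ≤ C · √( √((∫η₀)(∫r²η₀)) · M )`.
[cite: GallaySverak2016, Prop. 2.6 (2.14), Lemma 5.1, Lemma 6.4 (arXiv pp. 8, 16, 19)] -/
theorem GallaySverak2015.speedCap :
    ∃ C : ℝ, 0 ≤ C ∧
      ∀ ⦃T : ℝ⦄ ⦃u₀ : EuclideanSpace ℝ (Fin 3) → EuclideanSpace ℝ (Fin 3)⦄
        ⦃u : ℝ → EuclideanSpace ℝ (Fin 3) → EuclideanSpace ℝ (Fin 3)⦄
        ⦃p : ℝ → EuclideanSpace ℝ (Fin 3) → ℝ⦄ ⦃M : ℝ⦄,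
        0 < T → IsTaoSolutionOn T 1 u₀ u p → IsAxisymmetric u₀ → HasNoSwirl u₀ →
        (∀ x, 0 ≤ angVortQuot u₀ x) → (∀ x, angVortQuot u₀ x ≤ M) →
        Integrable (angVortQuot u₀) → Integrable (fun x => cylRadius x ^ 2 * angVortQuot u₀ x) →
        ∀ t ∈ Icc 0 T, ∀ x,
          ‖u t x‖ ≤ C * Real.sqrt (Real.sqrt ((∫ y, angVortQuot u₀ y) *
            ∫ y, cylRadius y ^ 2 * angVortQuot u₀ y) * M) :=
  speedCap_of_facts GallaySverak2015.VelocitySupBound_holds GallaySverak2015.ImpulseConservation_holds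

/-! ### The `L¹` bound on the vorticity, unconditional -/

section VorticityL1

variable {T : ℝ} {u₀ : EuclideanSpace ℝ (Fin 3) → EuclideanSpace ℝ (Fin 3)}
  {u : ℝ → EuclideanSpace ℝ (Fin 3) → EuclideanSpace ℝ (Fin 3)}
  {p : ℝ → EuclideanSpace ℝ (Fin 3) → ℝ}

/-- For a Tao-class solution (`ν = 1`) from an axisymmetric swirl-free datum with `0 ≤ η₀`,
`η₀ ∈ L¹`, `r²η₀ ∈ L¹`: at every `t ∈ [0, T]` the vorticity `ω(t) = curl u(t)` is integrable and
`∫‖ω(t)‖ dx ≤ √((∫η₀ dx)(∫r²η₀ dx))`. Proof: `‖ω(t)‖ = r|η(t)|` with `η(t) ≥ 0`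
(sign persistence), `∫η(t) ≤ ∫η₀` (Lemma 5.1), `∫r²η(t) = ∫r²η₀` (Lemma 6.4, theorem
`ImpulseConservation_holds`), and Cauchy–Schwarz `∫r|η| ≤ (∫|η|)^{1/2}(∫r²|η|)^{1/2}`.
[cite: GallaySverak2016, Lemma 5.1, Lemma 6.4 (arXiv pp. 16, 19)] -/
theorem IsTaoSolutionOn.integrable_curl_and_integral_norm_curl_le_of_datum (hT : 0 < T)
    (h : IsTaoSolutionOn T 1 u₀ u p) (h0 : IsAxisymmetric u₀) (h0' : HasNoSwirl u₀)
    (hη0 : ∀ x, 0 ≤ angVortQuot u₀ x) (hL1 : Integrable (angVortQuot u₀))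
    (hImp : Integrable (fun x => cylRadius x ^ 2 * angVortQuot u₀ x)) {t : ℝ} (ht : t ∈ Icc 0 T) :
    Integrable (curl (u t)) ∧
      ∫ y, ‖curl (u t) y‖ ≤ Real.sqrt ((∫ y, angVortQuot u₀ y) *
        ∫ y, cylRadius y ^ 2 * angVortQuot u₀ y) := by
  have h0T : (0 : ℝ) ∈ Icc 0 T := ⟨le_rfl, hT.le⟩
  -- the slice at time `t`
  have hax : IsAxisymmetric (u t) := h.isAxisymmetric one_pos hT h0 t ht
  have hsw : HasNoSwirl (u t) := h.hasNoSwirl one_pos hT h0 h0' t ht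
  have hu3 : ContDiff ℝ 3 (u t) := (h.classical.contDiff_velocity ht).of_le (by norm_cast)
  have hu1 : ContDiff ℝ 1 (u t) := hu3.of_le (by norm_cast)
  have hηc : Continuous (angVortQuot (u t)) :=
    (contDiff_angVortQuot (n := 0) (by exact_mod_cast hu3)).continuous
  have hηt0 : ∀ y, 0 ≤ angVortQuot (u t) y := fun y =>
    h.angVortQuot_nonneg_of_datum hT one_pos h0 h0' hη0 ht y
  have hωeq : ∀ y, ‖curl (u t) y‖ = cylRadius y * |angVortQuot (u t) y| :=
    norm_curl_eq_cylRadius_mul_abs_angVortQuot hax hsw hu3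
  -- `η(t) ∈ L¹` with `∫|η(t)| ≤ ∫η₀` (Lemma 5.1, tree)
  have hlin : ∫⁻ y, ‖angVortQuot (u t) y‖ₑ ≤ ∫⁻ y, ‖angVortQuot u₀ y‖ₑ := by
    have := h.lintegral_abs_angVortQuot_le_of_datum hT one_pos h0 h0' h0T ht ht.1
    rwa [h.initial] at this
  have hηint : Integrable (angVortQuot (u t)) :=
    ⟨hηc.aestronglyMeasurable, lt_of_le_of_lt hlin hL1.hasFiniteIntegral⟩
  have hA : ∫ y, |angVortQuot (u t) y| ≤ ∫ y, angVortQuot u₀ y := by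
    have e1 : ∫ y, |angVortQuot (u t) y| = (∫⁻ y, ‖angVortQuot (u t) y‖ₑ).toReal := by
      rw [← integral_norm_eq_lintegral_enorm hηc.aestronglyMeasurable]
      simp only [Real.norm_eq_abs]
    have e2 : ∫ y, angVortQuot u₀ y = (∫⁻ y, ‖angVortQuot u₀ y‖ₑ).toReal := by
      rw [← integral_norm_eq_lintegral_enorm hL1.aestronglyMeasurable]
      exact integral_congr_ae (Eventually.of_forall fun y => by
        simp only [Real.norm_eq_abs, abs_of_nonneg (hη0 y)])
    rw [e1, e2]
    exact ENNReal.toReal_mono hL1.hasFiniteIntegral.ne hlin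
  -- the impulse at time `t` (Lemma 6.4, theorem)
  obtain ⟨hIt, hIeq⟩ := GallaySverak2015.ImpulseConservation_holds hT h h0 h0' hη0 hL1 hImp t ht
  have hB : ∫ y, cylRadius y ^ 2 * |angVortQuot (u t) y| =
      ∫ y, cylRadius y ^ 2 * angVortQuot u₀ y := by
    rw [← hIeq]
    exact integral_congr_ae (Eventually.of_forall fun y => by
      simp only [abs_of_nonneg (hηt0 y)])
  -- `ω(t) ∈ L¹`: pointwise `r|η| ≤ (|η| + r²η)/2`
  have hωc : Continuous (curl (u t)) := continuous_curl hu1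
  have hωint : Integrable (curl (u t)) := by
    refine Integrable.mono' ((hηint.abs.add hIt).div_const 2) hωc.aestronglyMeasurable
      (Eventually.of_forall fun y => ?_)
    show ‖curl (u t) y‖ ≤ (|angVortQuot (u t) y| + cylRadius y ^ 2 * angVortQuot (u t) y) / 2
    rw [hωeq y]
    have e : cylRadius y ^ 2 * angVortQuot (u t) y = cylRadius y ^ 2 * |angVortQuot (u t) y| := by
      rw [abs_of_nonneg (hηt0 y)]
    rw [e]
    nlinarith [mul_nonneg (sq_nonneg (cylRadius y - 1)) (abs_nonneg (angVortQuot (u t) y))]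
  refine ⟨hωint, ?_⟩
  -- Cauchy–Schwarz
  have hIt' : Integrable fun y => cylRadius y ^ 2 * angVortQuot (u t) y := hIt
  calc ∫ y, ‖curl (u t) y‖ = ∫ y, cylRadius y * |angVortQuot (u t) y| := integral_congr_ae
        (Eventually.of_forall fun y => hωeq y)
    _ ≤ Real.sqrt (∫ y, |angVortQuot (u t) y|) *
          Real.sqrt (∫ y, cylRadius y ^ 2 * |angVortQuot (u t) y|) :=
        integral_cylRadius_mul_le_sqrt hηint hIt'
    _ ≤ Real.sqrt (∫ y, angVortQuot u₀ y) *
          Real.sqrt (∫ y, cylRadius y ^ 2 * angVortQuot u₀ y) := by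
        rw [hB]
        exact mul_le_mul_of_nonneg_right (Real.sqrt_le_sqrt hA) (Real.sqrt_nonneg _)
    _ = Real.sqrt ((∫ y, angVortQuot u₀ y) * ∫ y, cylRadius y ^ 2 * angVortQuot u₀ y) := by
        rw [Real.sqrt_mul (integral_nonneg fun y => hη0 y)]

/-- The `L¹` bound alone: `∫‖curl u(t)‖ dx ≤ √((∫η₀ dx)(∫r²η₀ dx))` on `[0, T]`.
[cite: GallaySverak2016, Lemma 5.1, Lemma 6.4 (arXiv pp. 16, 19)] -/
theorem IsTaoSolutionOn.integral_norm_curl_le_sqrt_of_datum (hT : 0 < T)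
    (h : IsTaoSolutionOn T 1 u₀ u p) (h0 : IsAxisymmetric u₀) (h0' : HasNoSwirl u₀)
    (hη0 : ∀ x, 0 ≤ angVortQuot u₀ x) (hL1 : Integrable (angVortQuot u₀))
    (hImp : Integrable (fun x => cylRadius x ^ 2 * angVortQuot u₀ x)) {t : ℝ} (ht : t ∈ Icc 0 T) :
    ∫ y, ‖curl (u t) y‖ ≤ Real.sqrt ((∫ y, angVortQuot u₀ y) *
      ∫ y, cylRadius y ^ 2 * angVortQuot u₀ y) :=
  (h.integrable_curl_and_integral_norm_curl_le_of_datum hT h0 h0' hη0 hL1 hImp ht).2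

end VorticityL1

/-! ### The cap with its number -/

/-- **All-time speed cap with the explicit constant `3`.** For every Tao-class solution `(u, p)` on
`[0, T]` (`0 < T`, `ν = 1`) of the unforced Navier–Stokes system from an axisymmetric swirl-free
datum `u₀` with `0 ≤ η₀ = angVortQuot u₀ ≤ M`, `η₀ ∈ L¹(ℝ³)`, `r²η₀ ∈ L¹(ℝ³)`, every
`t ∈ [0, T]` and every `x ∈ ℝ³`:

  `‖u(t, x)‖ ≤ 3 · √( √((∫η₀ dx)(∫r²η₀ dx)) · M ) = 3 (∫η₀)^{1/4} (∫r²η₀)^{1/4} M^{1/2}`.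

Proof: `ω(t) ∈ L¹` with `∫‖ω(t)‖ ≤ √((∫η₀)(∫r²η₀))`
(`integrable_curl_and_integral_norm_curl_le_of_datum`), `‖ω(t, y)‖ ≤ M·r` (maximum principle,
`norm_curl_le_mul_cylRadius_of_datum`), `ω(t)` is axisymmetric (`IsAxisymmetric.curl`) so
`‖ω(t)(rotZ θ y)‖ = ‖ω(t) y‖`, `u(t) = biotSavart ω(t)` (`IsTaoSolutionOn.biotSavart_curl_eq`),
and the tree's form of (2.14) with constant `3` (`norm_biotSavart_le_sqrt_of_norm_le_mul_cylRadius`)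
gives `‖u(t, x)‖ ≤ 3√((∫‖ω(t)‖) M)`. The constant `3` is the tree's, in the normalisation
`dx = r dr dθ dz`; the paper leaves `C` in (2.14) unspecified.
[cite: GallaySverak2016, Prop. 2.6 (2.14), Lemma 5.1, Lemma 6.4 (arXiv pp. 8, 16, 19)] -/
theorem GallaySverak2015.speedCap_three
    ⦃T : ℝ⦄ ⦃u₀ : EuclideanSpace ℝ (Fin 3) → EuclideanSpace ℝ (Fin 3)⦄
    ⦃u : ℝ → EuclideanSpace ℝ (Fin 3) → EuclideanSpace ℝ (Fin 3)⦄
    ⦃p : ℝ → EuclideanSpace ℝ (Fin 3) → ℝ⦄ ⦃M : ℝ⦄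
    (hT : 0 < T) (h : IsTaoSolutionOn T 1 u₀ u p) (h0 : IsAxisymmetric u₀) (h0' : HasNoSwirl u₀)
    (hη0 : ∀ x, 0 ≤ angVortQuot u₀ x) (hηM : ∀ x, angVortQuot u₀ x ≤ M)
    (hL1 : Integrable (angVortQuot u₀))
    (hImp : Integrable (fun x => cylRadius x ^ 2 * angVortQuot u₀ x)) :
    ∀ t ∈ Icc 0 T, ∀ x,
      ‖u t x‖ ≤ 3 * Real.sqrt (Real.sqrt ((∫ y, angVortQuot u₀ y) *
        ∫ y, cylRadius y ^ 2 * angVortQuot u₀ y) * M) := by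
  intro t ht x
  have hM0 : 0 ≤ M := (hη0 0).trans (hηM 0)
  have hu3 : ContDiff ℝ 3 (u t) := (h.classical.contDiff_velocity ht).of_le (by norm_cast)
  have hu1 : ContDiff ℝ 1 (u t) := hu3.of_le (by norm_cast)
  have hax : IsAxisymmetric (u t) := h.isAxisymmetric one_pos hT h0 t ht
  have habs0 : ∀ y, |angVortQuot u₀ y| ≤ M := fun y => by
    rw [abs_of_nonneg (hη0 y)]; exact hηM y
  have hωr : ∀ y, ‖curl (u t) y‖ ≤ M * cylRadius y := fun y =>
    h.norm_curl_le_mul_cylRadius_of_datum hT one_pos h0 h0' habs0 ht y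
  obtain ⟨hωint, hAω⟩ :=
    h.integrable_curl_and_integral_norm_curl_le_of_datum hT h0 h0' hη0 hL1 hImp ht
  have hωc : Continuous (curl (u t)) := continuous_curl hu1
  have hωax : IsAxisymmetric (curl (u t)) := hax.curl (hu1.differentiable (by simp))
  have hBSt := norm_biotSavart_le_sqrt_of_norm_le_mul_cylRadius hωc hωint
    (fun θ y => by rw [hωax θ y, norm_rotZ]) hωr x
  rw [h.biotSavart_curl_eq ht hωint] at hBSt
  refine hBSt.trans (mul_le_mul_of_nonneg_left (Real.sqrt_le_sqrt ?_) (by norm_num))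
  exact mul_le_mul_of_nonneg_right hAω hM0

end Literature.Analysis.FluidPDE

end
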